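import Summits.QuantumFields.BalabanUV.Beta.GAN24.VolumeLimitCovariance

/-!
# `BalabanUV.Beta.GAN24.FinePropagatorDecay` — binder row G-an2-4 ∕ (CONV-C), route R7 «TWO CURRENCIES», PART 145: THE ENTRYWISE DECAY OF THE FINE PROPAGATOR `𝒢^{(k)} = Δ_a⁻¹` AT PAIRS,
# VOLUME-FREE — in the BLOCK distance (`‖𝒢^{(k)}((w,λ),(y,ν))‖ ≤ (e^{4κ}∕γ_w)·e^{−κ·tdist(block w, block y)}`, every torus `M`, every level `k`, constants from `(d, a)` only) and, on the
# cubic tori, in the fine WINDOW currency of PARTs 142 ∕ 144 (`≤ C·e^{κ}·e^{−(κ∕(d·n_k))|windowMap(w − y)|₁}`, `n_k = L^k`).  This is NE2's Combes–Thomas station (`conjDefect_calDalev_rho` ⨾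
# `wCoercive_calDa_of_conjDefect`) read entrywise through `WCoercive.pairing_decay_inv` with the King weight `ρ_{k,y₀} − 1` (PART 126's `conjMat_sub_const`, `rho_le_one_of_near`,
# `distK_sub_three_le_rho_of_near`), and the β-cell's fine-versus-block distance inequality `VectorTailsCov.natAbs_liftZ_sub_le`.  It is input (b) of PART 144's `exists_tendsto_inv_pair` ∕
# `tendsto_mul_pair` on the fine torus `Site d (n_k·s) × Fin d` — the window decay the u-derivative sector's fine-level insertion `𝒢P𝒢` needs (census V182) (unit b2b-balaban-gan24-p3, gen 54; v1)

NOT IN PRINT; OUR PROOF ([folklore] bookkeeping BY NAME over NE2's `CTConjDefectDischarge.conjDefect_calDalev_rho`, `CTConjugatedHbd.wCoercive_calDa_of_conjDefect`,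
`CTWeightedCoercivity.WCoercive.pairing_decay_inv`, `KingPairingPlantedLaw.calDalev_inv`, PART 126 (`conjMat_sub_const`, `rho_le_one_of_near`, `distK_sub_three_le_rho_of_near`), PART 127
(`toM_bijective`), PART 124 (`exists_admissible_rate`), the β-cell's `VectorTailsCov.natAbs_liftZ_sub_le`, `tdist_self ∕ tdist_comm`, `PoissonInterior.natAbs_le_supNorm`,
`InfiniteVolumeRate.windowMap_apply_eq_valMinAbs`; [Balaban1984PropagatorsI] (1.89) p. 33 ∕ p. 36 LOCATE the decay of `G`; nothing printed is a hypothesis).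
HONEST FRAMING (cell contract, verbatim): «discharging `BetaPertH` makes Bałaban's UV stability UNCONDITIONAL — a real constructive-QFT result; it is NOT the
continuum limit and NOT the Clay problem.»  HONEST DEPENDENCY (verbatim): «continuum YM on T⁴ ⇐ BetaPertH ∧ nine spine estimates (0/9 proved); BetaPertH ⇐
(D1) ∧ (D4) ∧ CAP+tail; G-an2-4 gates asym, D1 and NE2/3/4.»

WHAT THIS FILE PROVES (0 sorry, 0 `def`):
* §1 `single_pairing` (`⟨δ_i, A δ_j⟩ = A i j`), `nsq_single`, `wCoercive_sub_const` (weighted coercivity is invariant under constant shifts of the weight).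
* §2 **`exists_blockDecay_calGlev`** — `∃ κ > 0, γ > 0` (from `(d, a)`): for EVERY torus `M`, level `k` and fine pair, `‖𝒢^{(k)}((w,λ),(y,ν))‖ ≤ e^{4κ}∕γ · e^{−κ·tdist(blockOf w, blockOf y)}`.
* §3 `l1_windowMap_le_block` (cubic tori: `|windowMap_{n s}(w − y)|₁ ≤ d·n·(tdist(blockOf w, blockOf y) + 1)`), **`exists_fineWindowDecay_calGlev`** — `∃ κ > 0, C ≥ 0` (from `(d, a)`): on every cubic
  torus and level, `‖𝒢^{(k)}((w,λ),(y,ν))‖ ≤ C·e^{−(κ∕(d·n_k))·|windowMap_{n_k s}(w − y)|₁}` — input (b) of PART 144 on the fine torus.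
WHAT IT DOES NOT DO: the `k`-UNIFORM fine decay (the rate `κ∕(d n_k)` in fine units IS the k-uniform rate `κ∕d` in unit-lattice units — the block form §2 is the uniform statement); backgrounds `U ≠ 1`;
the EL₂ of `𝒢P𝒢` (census V182: needs the background's volume limit).  SUPPLIER work; NEVER «G-an2-4 closed»; NOT (CONV-C), NOT D1, NOT `BetaPertH`, NOT continuum, NOT Clay.
Records: `HOME/b2b-balaban-gan24-p3/gen54/README.md`.
-/

noncomputable section

open scoped BigOperators ComplexConjugate Matrix Matrix.Norms.L2Operator
open Filter Topology

namespace Summit.QuantumFields.BalabanUV.Beta.GAN24.FinePropagatorDecay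

open Literature.MathematicalPhysics.QuantumFieldTheory.Balaban1983to89
open Literature.MathematicalPhysics.QuantumFieldTheory.Balaban1983to89.B5Prop11Plancherel (Tor fine)
open Literature.MathematicalPhysics.QuantumFieldTheory.Balaban1983to89.B5Prop11Lower (nsq nsq_nonneg)
open Literature.MathematicalPhysics.QuantumFieldTheory.Balaban1983to89.B5G183RateUnitTower (lev)
open Literature.MathematicalPhysics.QuantumFieldTheory.Balaban1983to89.B12Sec2to5 (l1)
open Literature.MathematicalPhysics.QuantumFieldTheory.Balaban1983to89.Beta (Site windowMap)
open Literature.MathematicalPhysics.QuantumFieldTheory.Balaban1983to89.Beta.FreeLegDictionary (cubic)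
open Literature.MathematicalPhysics.QuantumFieldTheory.Balaban1983to89.Beta.VectorTails (liftZ)
open Literature.MathematicalPhysics.QuantumFieldTheory.Balaban1983to89.Beta.VectorTailsCov (tdist tdist_self tdist_comm natAbs_liftZ_sub_le)
open Literature.MathematicalPhysics.QuantumFieldTheory.Balaban1983to89.Beta.PoissonInterior (supNorm natAbs_le_supNorm)
open Summit.QuantumFields.BalabanUV.T4Continuum
open Summit.QuantumFields.BalabanUV.T4Continuum.BalabanAveragedTowerUnit (idx calGlev one_le_lev')
open Summit.QuantumFields.BalabanUV.T4Continuum.KingPairingPlantedLaw (calDalev calDalev_inv)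
open Summit.QuantumFields.BalabanUV.T4Continuum.CTWeightedCoercivity (conjMat WCoercive conjForm_eq)
open Summit.QuantumFields.BalabanUV.T4Continuum.CTKingTowerWeights (rho distK toM)
open Summit.QuantumFields.BalabanUV.T4Continuum.CTConjugatedHbd (wCoercive_calDa_of_conjDefect)
open Summit.QuantumFields.BalabanUV.T4Continuum.CTConjDefectDischarge (conjDefect_calDalev_rho max_JA_lt_gamD)
open Summit.QuantumFields.BalabanUV.T4Continuum.DirichletRegionTower (gamD)
open Summit.QuantumFields.BalabanUV.T4Continuum.CTVectorPropagator (JA)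
open Summit.QuantumFields.BalabanUV.Beta.GAN24.InsertionChainDecay (exists_admissible_rate)
open Summit.QuantumFields.BalabanUV.Beta.GAN24.InsertionChainDecayBalaban (conjMat_sub_const rho_le_one_of_near distK_sub_three_le_rho_of_near)
open Summit.QuantumFields.BalabanUV.Beta.GAN24.UnitLatticeDecayAlgebra (toM_bijective)

variable {d : ℕ} (L : ℕ) [NeZero L]

/-! ## §1 Pairings with indicator vectors; constant shifts of the weight -/

section Generic

variable {ι : Type*} [Fintype ι] [DecidableEq ι]

/-- `⟨δ_i, A δ_j⟩ = A i j`. [folklore] -/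
theorem single_pairing (A : Matrix ι ι ℂ) (i j : ι) : star (Pi.single i (1 : ℂ) : ι → ℂ) ⬝ᵥ (A *ᵥ Pi.single j 1) = A i j := by
  have h1 : star (Pi.single i (1 : ℂ) : ι → ℂ) = Pi.single i 1 := by
    funext k; by_cases hk : k = i
    · subst hk; simp
    · simp [Pi.single_eq_of_ne hk]
  rw [h1, single_one_dotProduct, Matrix.mulVec, dotProduct_single_one]

/-- `Σ|δ_i|² = 1`. [folklore] -/
theorem nsq_single (i : ι) : nsq (Pi.single i (1 : ℂ) : ι → ℂ) = 1 := by
  simp only [nsq, Pi.single_apply, apply_ite norm, norm_one, norm_zero]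
  simp [Finset.sum_ite_eq']

omit [DecidableEq ι] in
/-- weighted coercivity is invariant under a constant shift of the weight (the conjugation `e^{κρ} A e^{−κρ}` only sees differences of `ρ`). [folklore] -/
theorem wCoercive_sub_const {A : Matrix ι ι ℂ} {κ γw : ℝ} {ρ : ι → ℝ} (h : WCoercive A κ ρ γw) (c : ℝ) : WCoercive A κ (fun e => ρ e - c) γw := by
  intro z
  have hz := h z
  rw [conjForm_eq] at hz ⊢
  rwa [conjMat_sub_const]

end Generic

/-! ## §2 Block-distance decay of the fine propagator, every torus, every level -/

variable (a : ℝ) (ha : 0 < a)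

/-- **`exists_blockDecay_calGlev` — THE FINE PROPAGATOR DECAYS IN THE BLOCK DISTANCE, VOLUME- AND LEVEL-FREE** [our proof]: `∃ κ > 0, γ > 0` depending on `(d, a)` only such that for EVERY
torus `M`, every level `k`, all fine sites `w, y` and directions `λ, ν`: `‖𝒢^{(k)}((w,λ),(y,ν))‖ ≤ (e^{4κ}∕γ)·e^{−κ·tdist(blockOf w, blockOf y)}` — NE2's weighted coercivity of
`Δ_a^{(k)} = calDalev k` with King's weight centred at the block of `y` (shifted by `1` so that it is `≤ 0` on that block and `≥ distK − 4` on the block of `w`), read through the Combes–Thomas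
pairing bound for the inverse with indicator vectors. [cite: Balaban1984PropagatorsI, Prop. 1.1 (1.89) p.33, p.36 (decay of `G`: the object)] -/
theorem exists_blockDecay_calGlev :
    ∃ κ γ : ℝ, 0 < κ ∧ 0 < γ ∧ ∀ (M : Fin d → ℕ) [∀ μ, NeZero (M μ)] (k : ℕ) (w y : Tor (fine (lev L k) M)) (l ν : Fin d),
      ‖calGlev L M a ha k (w, l) (y, ν)‖ ≤ Real.exp (κ * 4) / γ * Real.exp (-(κ * (tdist (B5Blocks16.blockOf (lev L k) M w) (B5Blocks16.blockOf (lev L k) M y) : ℝ))) := by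
  obtain ⟨κ, hκ0, -, hγ', hδ', hJA⟩ := exists_admissible_rate d a
  have hJγ : max (JA d a 1 κ 1) 0 < gamD d a := max_JA_lt_gamD a hJA
  refine ⟨κ, gamD d a - max (JA d a 1 κ 1) 0, hκ0, sub_pos.mpr hJγ, fun M _ k w y l ν => ?_⟩
  -- unit sites labelling the two blocks
  obtain ⟨x₀, hx₀⟩ := (toM_bijective L M).2 (B5Blocks16.blockOf (lev L k) M w)
  obtain ⟨y₀, hy₀⟩ := (toM_bijective L M).2 (B5Blocks16.blockOf (lev L k) M y)
  have hW : WCoercive (calDalev L M a ha k) κ (rho L M k (y₀, ν)) (gamD d a - max (JA d a 1 κ 1) 0) :=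
    wCoercive_calDa_of_conjDefect (lev L k) (one_le_lev' L k) M a ha (conjDefect_calDalev_rho L M a ha one_pos hγ' hδ' k (y₀, ν))
  have hW' := wCoercive_sub_const hW 1
  have hnear_w : tdist (toM L M (x₀, l).1) (B5Blocks16.blockOf (lev L k) M (w, l).1) ≤ 1 := by
    simp only [hx₀, tdist_self]; exact zero_le_one
  have hnear_y : tdist (toM L M (y₀, ν).1) (B5Blocks16.blockOf (lev L k) M (y, ν).1) ≤ 1 := by
    simp only [hy₀, tdist_self]; exact zero_le_one
  have hu : ∀ e : idx L M k, (Pi.single (w, l) (1 : ℂ) : idx L M k → ℂ) e ≠ 0 → distK L M (x₀, l) (y₀, ν) - 4 ≤ rho L M k (y₀, ν) e - 1 := by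
    intro e he
    have : e = (w, l) := by by_contra hne; exact he (Pi.single_eq_of_ne hne _)
    subst this
    have := distK_sub_three_le_rho_of_near L M k (x₀, l) (y₀, ν) (w, l) hnear_w
    linarith
  have hv : ∀ e : idx L M k, (Pi.single (y, ν) (1 : ℂ) : idx L M k → ℂ) e ≠ 0 → rho L M k (y₀, ν) e - 1 ≤ 0 := by
    intro e he
    have : e = (y, ν) := by by_contra hne; exact he (Pi.single_eq_of_ne hne _)
    subst this
    have := rho_le_one_of_near L M k (y₀, ν) (y, ν) hnear_y
    linarith
  have h := hW'.pairing_decay_inv (sub_pos.mpr hJγ) hκ0.le (u := (Pi.single (w, l) (1 : ℂ) : idx L M k → ℂ)) (v := (Pi.single (y, ν) (1 : ℂ) : idx L M k → ℂ)) (R := distK L M (x₀, l) (y₀, ν) - 4) hu hv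
  rw [calDalev_inv, single_pairing, nsq_single, nsq_single, Real.sqrt_one, mul_one, mul_one] at h
  refine h.trans (le_of_eq ?_)
  have hdist : distK L M (x₀, l) (y₀, ν) = (tdist (B5Blocks16.blockOf (lev L k) M w) (B5Blocks16.blockOf (lev L k) M y) : ℝ) := by
    unfold distK; rw [hx₀, hy₀]
  rw [hdist, show -(κ * ((tdist (B5Blocks16.blockOf (lev L k) M w) (B5Blocks16.blockOf (lev L k) M y) : ℝ) - 4))
      = κ * 4 + -(κ * (tdist (B5Blocks16.blockOf (lev L k) M w) (B5Blocks16.blockOf (lev L k) M y) : ℝ)) by ring, Real.exp_add]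
  ring

/-! ## §3 On cubic tori: the fine window currency -/

omit [NeZero L] in
/-- **fine window norm versus block distance** (cubic tori): `|windowMap_{n s}(w − y)|₁ ≤ d·n·(tdist(blockOf w, blockOf y) + 1)` — coordinatewise the β-cell's
`natAbs_liftZ_sub_le` (`|v_i| ≤ n·|liftZ(block difference)_i| + (n − 1)`) and `|liftZ(·)_i| ≤ supNorm = tdist`. [folklore] -/
theorem l1_windowMap_le_block (n s : ℕ) [NeZero n] [NeZero s] (w y : Tor (fine n (cubic d s))) :
    l1 (windowMap d (n * s) (w - y)) ≤ d * n * ((tdist (B5Blocks16.blockOf n (cubic d s) w) (B5Blocks16.blockOf n (cubic d s) y) : ℝ) + 1) := by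
  have hco : ∀ i, |(windowMap d (n * s) (w - y) i : ℝ)| ≤ n * ((tdist (B5Blocks16.blockOf n (cubic d s) w) (B5Blocks16.blockOf n (cubic d s) y) : ℝ) + 1) := by
    intro i
    have e : windowMap d (n * s) (w - y) i = liftZ (N := fine n (cubic d s)) (w - y) i := by
      rw [Beta.windowMap_apply_eq_valMinAbs]; rfl
    have h1 := (natAbs_liftZ_sub_le n (cubic d s) w y i).1
    have h2 : (liftZ (B5Blocks16.blockOf n (cubic d s) w - B5Blocks16.blockOf n (cubic d s) y) i).natAbs ≤ tdist (B5Blocks16.blockOf n (cubic d s) y) (B5Blocks16.blockOf n (cubic d s) w) := by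
      unfold tdist; exact natAbs_le_supNorm _ i
    rw [tdist_comm] at h2
    have h3 : (liftZ (N := fine n (cubic d s)) (w - y) i).natAbs ≤ n * tdist (B5Blocks16.blockOf n (cubic d s) w) (B5Blocks16.blockOf n (cubic d s) y) + n := by
      calc _ ≤ n * (liftZ (B5Blocks16.blockOf n (cubic d s) w - B5Blocks16.blockOf n (cubic d s) y) i).natAbs + (n - 1) := h1
        _ ≤ n * tdist (B5Blocks16.blockOf n (cubic d s) w) (B5Blocks16.blockOf n (cubic d s) y) + n := by
            have := Nat.sub_le n 1; gcongr
    rw [e, ← Int.cast_abs, ← Nat.cast_natAbs]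
    have h4 : ((liftZ (N := fine n (cubic d s)) (w - y) i).natAbs : ℝ) ≤ n * (tdist (B5Blocks16.blockOf n (cubic d s) w) (B5Blocks16.blockOf n (cubic d s) y) : ℝ) + n := by exact_mod_cast h3
    linarith
  calc l1 (windowMap d (n * s) (w - y)) = ∑ i, |(windowMap d (n * s) (w - y) i : ℝ)| := rfl
    _ ≤ ∑ _i : Fin d, (n : ℝ) * ((tdist (B5Blocks16.blockOf n (cubic d s) w) (B5Blocks16.blockOf n (cubic d s) y) : ℝ) + 1) := Finset.sum_le_sum fun i _ => hco i
    _ = d * n * ((tdist (B5Blocks16.blockOf n (cubic d s) w) (B5Blocks16.blockOf n (cubic d s) y) : ℝ) + 1) := by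
        rw [Finset.sum_const, Finset.card_univ, Fintype.card_fin, nsmul_eq_mul]; ring

/-- **`exists_fineWindowDecay_calGlev` — THE FINE PROPAGATOR'S WINDOW DECAY AT PAIRS ON CUBIC TORI, VOLUME-FREE** [our proof]: `∃ κ > 0, C ≥ 0` (from `(d, a)`) such that on every cubic
torus `(ℤ∕s)^d`, every level `k` (`n_k = L^k`) and all fine pairs, `‖𝒢^{(k)}((w,λ),(y,ν))‖ ≤ C·e^{−(κ∕(d·n_k))·|windowMap_{n_k s}(w − y)|₁}` — input (b) of PART 144's
`tendsto_mul_pair` ∕ `exists_tendsto_inv_pair` on the fine torus `Site d (n_k s) × Fin d` (`Tor (fine n_k (cubic d s)) = Site d (n_k s)` definitionally). -/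
theorem exists_fineWindowDecay_calGlev :
    ∃ κ C : ℝ, 0 < κ ∧ 0 ≤ C ∧ ∀ (s : ℕ) [NeZero s] (k : ℕ) (w y : Tor (fine (lev L k) (cubic d s))) (l ν : Fin d),
      ‖calGlev L (cubic d s) a ha k (w, l) (y, ν)‖ ≤ C * Real.exp (-(κ / (d * lev L k)) * l1 (windowMap d (lev L k * s) (w - y))) := by
  obtain ⟨κ, γ, hκ, hγ, h⟩ := exists_blockDecay_calGlev L a ha
  refine ⟨κ, Real.exp (κ * 4) / γ * Real.exp κ, hκ, by positivity, fun s _ k w y l ν => ?_⟩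
  refine (h (cubic d s) k w y l ν).trans ?_
  rw [mul_assoc]
  refine mul_le_mul_of_nonneg_left ?_ (by positivity)
  rw [← Real.exp_add]
  refine Real.exp_le_exp.mpr ?_
  have hn : (0 : ℝ) < lev L k := by exact_mod_cast Nat.pos_of_ne_zero (NeZero.ne (lev L k))
  -- `κ/(d n) · l1 ≤ κ (tdist + 1)`
  have key : κ / (d * lev L k) * l1 (windowMap d (lev L k * s) (w - y))
      ≤ κ * ((tdist (B5Blocks16.blockOf (lev L k) (cubic d s) w) (B5Blocks16.blockOf (lev L k) (cubic d s) y) : ℝ) + 1) := by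
    rcases Nat.eq_zero_or_pos d with hd | hd
    · have hl0 : l1 (windowMap d (lev L k * s) (w - y)) = 0 := by subst hd; simp [l1]
      rw [hl0, mul_zero]; positivity
    have hd0 : (0 : ℝ) < d := by exact_mod_cast hd
    have hl := l1_windowMap_le_block (lev L k) s w y
    rw [div_mul_eq_mul_div, div_le_iff₀ (mul_pos hd0 hn)]
    calc κ * l1 (windowMap d (lev L k * s) (w - y))
        ≤ κ * (d * lev L k * ((tdist (B5Blocks16.blockOf (lev L k) (cubic d s) w) (B5Blocks16.blockOf (lev L k) (cubic d s) y) : ℝ) + 1)) :=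
          mul_le_mul_of_nonneg_left hl hκ.le
      _ = κ * ((tdist (B5Blocks16.blockOf (lev L k) (cubic d s) w) (B5Blocks16.blockOf (lev L k) (cubic d s) y) : ℝ) + 1) * (d * lev L k) := by ring
  linarith

end Summit.QuantumFields.BalabanUV.Beta.GAN24.FinePropagatorDecay

end
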